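import Literature.Computability.Cryptography.RegevSamplerMachineU
import Literature.Computability.QuantumComplexity.GRDataPar
import HarnessLib

/-!
# Regev 2009, Lemma 3.14 in machine form: the data-free machine circuit of the concrete Grover–Rudolph block

Topic `Computability/Cryptography` (family `pqc`), grouping namespace `Regev2009.SamplerRegs`; joins
`RegevSamplerMachineU.lean` (`machineCircU`: `machineCirc` with the data-free erase layer `cnotLayer σ T`;
`runOn_machineCircU_eq_runOn_machineCirc`) and `QuantumComplexity/GRDataPar.lean` (`GRData.parList E`: all parameter
wires; `GRData.parSrc E src`: their classical sources; `mem_eraseList_iff_mem_parList`).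

* `machineCircPar` — the machine circuit of the concrete block whose erase layer is the `CNOT` layer from the sources
  `src : Fin np → Fin W` onto ALL parameter wires: its gate list is a function of the sizes, the layout, the block
  embedding and `src` only — NOT of the parameter word (the instance data), cf. `machineCirc … (eraseList m E)`.
* `runOn_machineCircPar_eq_runOn_machineCirc` — **on every basis label carrying the parameter word `m.c` on the
  (off-block) sources, `machineCircPar` and `machineCirc … (GRData.eraseList m E)` produce the same state**; hence
  every law-level bound proved for `machineCirc` from such a label (`tvDist_machineCirc_le_std`, …) holds verbatim
  for the data-free circuit — the form a uniform circuit family indexed by the sizes can contain.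

Everything is proved; no named fact is introduced.
HONEST FRAMING: kernel-checked lemmas of a KNOWN reduction (Regev 2009) — not summit progress.

## References

* O. Regev, *On lattices, learning with errors, random linear codes, and cryptography*, J. ACM 56 (2009), art. 34:
  Lemma 3.14 (proof) [Regev2009].
* M. A. Nielsen, I. L. Chuang, *Quantum Computation and Quantum Information*, CUP 2010, §3.2.5, §4.3 [NielsenChuang2010].
-/

noncomputable section

namespace Literature.Computability.Cryptography

namespace Regev2009

namespace SamplerRegs

open Literature.Algebra.EuclideanLattices Literature.Computability.QuantumComplexity SamplerClassical SamplerClassical.Layout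
  SamplerSubst

variable {W : ℕ} (I : LatticeInstance) {Λ : Layout W I.n} (hΛ : Λ.OK)

/-- **The data-free machine circuit of the concrete Grover–Rudolph block**: `machineCircU` with the `CNOT` layer from
the sources `src` onto all parameter wires `GRData.parList E`. [cite: Regev2009, Lemma 3.14 (proof)] [cite: NielsenChuang2010, §3.2.5] -/
def machineCircPar (hF : Fits Λ) (Rf : UniformQCircuitFamily) (Z : SubZone Λ (Rf.family.ancillas Λ.kq))
    {np wlen kk : ℕ} {ag : Fin Λ.ℓ → (Fin Λ.ℓ → Bool) → ℝ}
    (D : GRBlock.Data (GRData.kit Λ.ℓ np wlen kk) (GRData.ws Λ.ℓ np wlen kk) (GRData.pw Λ.ℓ np wlen kk) ag)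
    (E : Fin I.n → (Fin (GRData.B Λ.ℓ np wlen kk) ↪ Fin W)) (src : Fin np → Fin W)
    (kF : ℕ) (hk : 1 ≤ kF) (hroom : Λ.base + I.n * QFTKit.qbsize Λ.ℓR kF ≤ W) : QCircuit cliffordT W :=
  machineCircU I hΛ hF Rf Z D E (GRData.parSrc E src) (GRData.parList E) kF hk hroom

/-- **The data-free machine circuit agrees with `machineCirc` on every basis label carrying the parameter word on the
off-block sources.** [cite: Regev2009, Lemma 3.14 (proof)] [cite: NielsenChuang2010, §3.2.5, §2.1.7] -/
theorem runOn_machineCircPar_eq_runOn_machineCirc (hF : Fits Λ) (Rf : UniformQCircuitFamily)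
    (Z : SubZone Λ (Rf.family.ancillas Λ.kq)) {np wlen kk : ℕ} {a ag : Fin Λ.ℓ → (Fin Λ.ℓ → Bool) → ℝ}
    (m : GRData.Mach Λ.ℓ np wlen kk a)
    (D : GRBlock.Data (GRData.kit Λ.ℓ np wlen kk) (GRData.ws Λ.ℓ np wlen kk) (GRData.pw Λ.ℓ np wlen kk) ag)
    {E : Fin I.n → (Fin (GRData.B Λ.ℓ np wlen kk) ↪ Fin W)} (hE : BlockDisjoint E) (src : Fin np → Fin W)
    (hsrc : ∀ t, OffBlocks E (src t)) (z : QReg W) (hz : ∀ t, z (src t) = m.c t)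
    (kF : ℕ) (hk : 1 ≤ kF) (hroom : Λ.base + I.n * QFTKit.qbsize Λ.ℓR kF ≤ W) :
    (machineCircPar I hΛ hF Rf Z D E src kF hk hroom).runOn 0 (basisState z) =
      (machineCirc I hΛ hF Rf Z D E (GRData.eraseList m E) kF hk hroom).runOn 0 (basisState z) :=
  runOn_machineCircU_eq_runOn_machineCirc I hΛ hF Rf Z D hE _ _ (GRData.nodup_parList hE)
    (GRData.parSrc_not_mem_parList hE src hsrc) (GRData.offBlocks_parSrc hE src hsrc) _ (GRData.nodup_eraseList m E hE) z
    (GRData.mem_eraseList_iff_mem_parList m hE src z hz) kF hk hroom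

end SamplerRegs

end Regev2009

end Literature.Computability.Cryptography

end
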